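import Literature.Probability.RandomPlanarGeometry.SAWPulledBridgeFreeEnergyZdThirdOrderEnvelope
import HarnessLib

/-!
# The pulled-bridge free energy on `ℤ^{d+1}` to THIRD order with an explicit remainder:
# `0 ≤ (y + 2d − 2d/y + 2d(2d+1)/y²) − e^{λ_B(y)} ≤ 24d⁴/y³` for every `y ≥ 1`

Topic `Literature/Probability/RandomPlanarGeometry` (continues `SAWPulledBridgeFreeEnergyZdThirdOrderEnvelope.lean`:
`exp_pulledBridgeFreeEnergy_le_third_order : E ≤ S₃ := y + 2d − 2d/y + 2d(2d+1)/y²`, `E = e^{λ_B(y)}`; and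
`SAWPulledBridgeFreeEnergyZdLowerEnvelope.lean`: the block laws `p₁ = u`, `p₂ = 2du²/y`, `p₃ = 2d(2d−1)u³/y²` and the gap-free
sub-Kesten inequality; the cost census `N_{3,4} = 2d(2d−1)²`, `N_{c,4} = 0` otherwise (`SAWPulledLargeForceExpansionZdThirdOrder`,
`…FirstOrder`, `…FourthOrder`)).

The FOURTH block of the pulled renewal structure is the span-one family `+e₀` followed by a 3-step lateral self-avoiding walk:
`p₄(y) = 2d(2d−1)²·u⁴/y³`.  The four-block sub-Kesten inequality `p₁ + p₂ + p₃ + p₄ ≤ 1` (every `y > 0`, no mass gap) is the QUARTIC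
lower envelope `E⁴ ≥ yE³ + 2dyE² + 2d(2d−1)yE + 2d(2d−1)²y`, i.e. `E − y ≥ 2dy/E + 2d(2d−1)y/E² + 2d(2d−1)²y/E³`; inserting the
third-order UPPER envelope `E ≤ S₃` of the previous file in the denominators and clearing them leaves a polynomial inequality in
`(y − 1, d − 1)` all of whose 82 coefficients are positive (`third_order_poly_certificate`).  Hence

* ★★ `exp_pulledBridgeFreeEnergy_quartic_le : y·E³ + 2d·y·E² + 2d(2d−1)·y·E + 2d(2d−1)²·y ≤ E⁴` (every `y > 0`, every `d`);
* ★★★ **`third_order_sub_le_exp_pulledBridgeFreeEnergy : y + 2d − 2d/y + 2d(2d+1)/y² − 24d⁴/y³ ≤ e^{λ_B(y)}`** (`y ≥ 1`, every `d`);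
* ★★★ **`abs_exp_pulledBridgeFreeEnergy_sub_third_order_le : |e^{λ_B(y)} − (y + 2d − 2d/y + 2d(2d+1)/y²)| ≤ 24d⁴/y³`** for every
  `y ≥ 1` and every `d` — the large-force expansion `1, 2d, −2d, 2d(2d+1), …` to THIRD order with an explicit remainder, uniform in the
  dimension (the tree's `exp_pulledBridgeFreeEnergy_third_order_zd` is the `∃ C y₁` form); `exp_pulledBridgeFreeEnergy_sub_third_order_mem_Icc`
  (`−24d⁴/y³ ≤ E − S₃ ≤ 0`).

Printed status: first order is Janse van Rensburg–Whittington (2013, §3.2 Theorem 8); explicit third-order two-sided envelopes uniform in `d` are, to our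
knowledge, not in print.  Provenance: lane «pcv-sawmu», a-p3 g26 (2026-08-28).  PURE STD, no data, no `decide`.
-/

noncomputable section

open Finset Filter Topology
open scoped BigOperators
open Literature.Probability.LatticeModels
open Literature.Probability.RandomPlanarGeometry.SAW

namespace Literature.Probability.RandomPlanarGeometry.SAW.Zd

/-! ### The fourth block and the quartic lower envelope -/

/-- `p_4(y) = 2d(2d−1)²·u⁴/y³` (the `2d(2d−1)²` irreducible bridges `+e₀` + a 3-step lateral self-avoiding walk; `N_{c,4} = 0` for `c ≠ 3`).
[cite: Beaton2015, §3, Lemma 1, eq. (7)] [cite: MadrasSlade1993, §4.2, eq. (4.2.20)–(4.2.22) (p. 94, 2013 reprint)] -/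
theorem pulledBlockLaw_four_eq (d : ℕ) {y : ℝ} (hy : 0 < y) :
    pulledBlockLaw (d + 1) y 4 = 2 * d * (2 * d - 1) ^ 2 * largeForceUZd d y ^ 4 / y ^ 3 := by
  rw [pulledBlockLaw_eq_sum_costCoeffZd d hy 4]
  simp only [Finset.sum_range_succ, Finset.sum_range_zero, costCoeffZd_zero, costCoeffZd_one_of_ne_two d (show (4 : ℕ) ≠ 2 by norm_num),
    costCoeffZd_two_four, costCoeffZd_three_four, costCoeffZd_eq_zero_of_le (d := d) (le_refl 4)]
  have h : ((2 * d * (2 * d - 1) ^ 2 : ℕ) : ℝ) = 2 * d * (2 * d - 1) ^ 2 := by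
    rcases Nat.eq_zero_or_pos d with rfl | hd
    · simp
    · rw [Nat.cast_mul, Nat.cast_pow, Nat.cast_mul, Nat.cast_sub (by omega)]; push_cast; ring
  rw [h]
  push_cast
  ring

/-- **The four-block sub-Kesten inequality**: `u + 2d·u²/y + 2d(2d−1)·u³/y² + 2d(2d−1)²·u⁴/y³ ≤ 1` for every `y > 0`.
[cite: Beaton2015, §3, Lemma 2; MadrasSlade1993, §4.2, eq. (4.2.15)] -/
theorem largeForceUZd_four_blocks_le_one (d : ℕ) {y : ℝ} (hy : 0 < y) :
    largeForceUZd d y + 2 * d * largeForceUZd d y ^ 2 / y + 2 * d * (2 * d - 1) * largeForceUZd d y ^ 3 / y ^ 2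
      + 2 * d * (2 * d - 1) ^ 2 * largeForceUZd d y ^ 4 / y ^ 3 ≤ 1 := by
  have h := sum_range_pulledBlockLaw_le_one d hy 5
  simp only [Finset.sum_range_succ, Finset.sum_range_zero, pulledBlockLaw_zero, pulledBlockLaw_one_eq_largeForceUZd,
    pulledBlockLaw_two_eq d hy, pulledBlockLaw_three_eq d hy, pulledBlockLaw_four_eq d hy, zero_add] at h
  exact h

/-- ★★ **The quartic lower envelope**: `y·E³ + 2d·y·E² + 2d(2d−1)·y·E + 2d(2d−1)²·y ≤ E⁴` for `E = e^{λ_B(y)}` on `ℤ^{d+1}`, every `y > 0`, every `d`.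
[cite: Beaton2015, §3, Lemma 2] [cite: JansevanRensburgWhittington2013, §3.2 Theorem 8 (arXiv v4 p. 11)] -/
theorem exp_pulledBridgeFreeEnergy_quartic_le (d : ℕ) {y : ℝ} (hy : 0 < y) :
    y * Real.exp (pulledBridgeFreeEnergy (d + 1) y) ^ 3 + 2 * d * y * Real.exp (pulledBridgeFreeEnergy (d + 1) y) ^ 2
        + 2 * d * (2 * d - 1) * y * Real.exp (pulledBridgeFreeEnergy (d + 1) y) + 2 * d * (2 * d - 1) ^ 2 * y
      ≤ Real.exp (pulledBridgeFreeEnergy (d + 1) y) ^ 4 := by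
  set E := Real.exp (pulledBridgeFreeEnergy (d + 1) y) with hE
  have hE0 : 0 < E := Real.exp_pos _
  have hu : largeForceUZd d y = y / E := by rw [largeForceUZd, Real.exp_neg, div_eq_mul_inv]
  have h := largeForceUZd_four_blocks_le_one d hy
  rw [hu] at h
  have key : y / E + 2 * d * (y / E) ^ 2 / y + 2 * d * (2 * d - 1) * (y / E) ^ 3 / y ^ 2 + 2 * d * (2 * d - 1) ^ 2 * (y / E) ^ 4 / y ^ 3
      = (y * E ^ 3 + 2 * d * y * E ^ 2 + 2 * d * (2 * d - 1) * y * E + 2 * d * (2 * d - 1) ^ 2 * y) / E ^ 4 := by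
    field_simp
  rw [key, div_le_one (by positivity)] at h
  exact h

/-- `E − y ≥ 2dy/E + 2d(2d−1)y/E² + 2d(2d−1)²y/E³` (the quartic envelope divided by `E³`). [cite: JansevanRensburgWhittington2013, §3.2 Theorem 8 (arXiv v4 p. 11)] -/
theorem three_blocks_div_le_exp_pulledBridgeFreeEnergy_sub (d : ℕ) {y : ℝ} (hy : 0 < y) :
    2 * d * y / Real.exp (pulledBridgeFreeEnergy (d + 1) y) + 2 * d * (2 * d - 1) * y / Real.exp (pulledBridgeFreeEnergy (d + 1) y) ^ 2
        + 2 * d * (2 * d - 1) ^ 2 * y / Real.exp (pulledBridgeFreeEnergy (d + 1) y) ^ 3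
      ≤ Real.exp (pulledBridgeFreeEnergy (d + 1) y) - y := by
  set E := Real.exp (pulledBridgeFreeEnergy (d + 1) y) with hE
  have hE0 : 0 < E := Real.exp_pos _
  have hq := exp_pulledBridgeFreeEnergy_quartic_le d hy
  have key : 2 * d * y / E + 2 * d * (2 * d - 1) * y / E ^ 2 + 2 * d * (2 * d - 1) ^ 2 * y / E ^ 3
      = (2 * d * y * E ^ 2 + 2 * d * (2 * d - 1) * y * E + 2 * d * (2 * d - 1) ^ 2 * y) / E ^ 3 := by
    field_simp
  rw [key, div_le_iff₀ (by positivity)]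
  nlinarith

/-! ### The polynomial certificate and the third-order lower envelope -/
set_option maxHeartbeats 400000 in
/-- **The positivity certificate**: with `y = 1 + t`, `d = 1 + e` (`t, e ≥ 0`) and `N = y³ + 2dy² − 2dy + 2d(2d+1)` (`= y²·S₃`), the polynomial
`y³·(2dy³N² + 2d(2d−1)y⁵N + 2d(2d−1)²y⁷) − (2dy³ − 2dy² + 2d(2d+1)y − 24d⁴)·N³` is a sum of 82 monomials in `(t, e)` with positive integer
coefficients, hence `≥ 0`. [folklore] -/
private theorem third_order_poly_certificate {y D : ℝ} (hy : 1 ≤ y) (hD : 1 ≤ D) :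
    0 ≤ y ^ 3 * (2 * D * y ^ 3 * (y ^ 3 + 2 * D * y ^ 2 - 2 * D * y + 2 * D * (2 * D + 1)) ^ 2
        + 2 * D * (2 * D - 1) * y ^ 5 * (y ^ 3 + 2 * D * y ^ 2 - 2 * D * y + 2 * D * (2 * D + 1))
        + 2 * D * (2 * D - 1) ^ 2 * y ^ 7)
      - (2 * D * y ^ 3 - 2 * D * y ^ 2 + 2 * D * (2 * D + 1) * y - 24 * D ^ 4)
        * (y ^ 3 + 2 * D * y ^ 2 - 2 * D * y + 2 * D * (2 * D + 1)) ^ 3 := by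
  obtain ⟨t, ht, rfl⟩ : ∃ t : ℝ, 0 ≤ t ∧ y = 1 + t := ⟨y - 1, by linarith, by ring⟩
  obtain ⟨e, he, rfl⟩ : ∃ e : ℝ, 0 ≤ e ∧ D = 1 + e := ⟨D - 1, by linarith, by ring⟩
  have key : (1 + t) ^ 3 * (2 * (1 + e) * (1 + t) ^ 3 * ((1 + t) ^ 3 + 2 * (1 + e) * (1 + t) ^ 2 - 2 * (1 + e) * (1 + t)
        + 2 * (1 + e) * (2 * (1 + e) + 1)) ^ 2
        + 2 * (1 + e) * (2 * (1 + e) - 1) * (1 + t) ^ 5 * ((1 + t) ^ 3 + 2 * (1 + e) * (1 + t) ^ 2 - 2 * (1 + e) * (1 + t)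
        + 2 * (1 + e) * (2 * (1 + e) + 1))
        + 2 * (1 + e) * (2 * (1 + e) - 1) ^ 2 * (1 + t) ^ 7)
      - (2 * (1 + e) * (1 + t) ^ 3 - 2 * (1 + e) * (1 + t) ^ 2 + 2 * (1 + e) * (2 * (1 + e) + 1) * (1 + t) - 24 * (1 + e) ^ 4)
        * ((1 + t) ^ 3 + 2 * (1 + e) * (1 + t) ^ 2 - 2 * (1 + e) * (1 + t) + 2 * (1 + e) * (2 * (1 + e) + 1)) ^ 3
      =
        6288 +
        56408 * e +
        223528 * e ^ 2 +
        518680 * e ^ 3 +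
        784008 * e ^ 4 +
        809296 * e ^ 5 +
        579264 * e ^ 6 +
        284480 * e ^ 7 +
        91904 * e ^ 8 +
        17664 * e ^ 9 +
        1536 * e ^ 10 +
        11356 * t +
        93720 * t * e +
        330436 * t * e ^ 2 +
        661696 * t * e ^ 3 +
        835432 * t * e ^ 4 +
        692624 * t * e ^ 5 +
        378016 * t * e ^ 6 +
        131136 * t * e ^ 7 +
        26240 * t * e ^ 8 +
        2304 * t * e ^ 9 +
        18500 * t ^ 2 +
        148312 * t ^ 2 * e +
        499652 * t ^ 2 * e ^ 2 +
        947312 * t ^ 2 * e ^ 3 +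
        1126400 * t ^ 2 * e ^ 4 +
        876960 * t ^ 2 * e ^ 5 +
        449120 * t ^ 2 * e ^ 6 +
        146432 * t ^ 2 * e ^ 7 +
        27648 * t ^ 2 * e ^ 8 +
        2304 * t ^ 2 * e ^ 9 +
        16804 * t ^ 3 +
        128864 * t ^ 3 * e +
        398004 * t ^ 3 * e ^ 2 +
        668584 * t ^ 3 * e ^ 3 +
        679168 * t ^ 3 * e ^ 4 +
        430736 * t ^ 3 * e ^ 5 +
        167296 * t ^ 3 * e ^ 6 +
        36544 * t ^ 3 * e ^ 7 +
        3456 * t ^ 3 * e ^ 8 +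
        13108 * t ^ 4 +
        98664 * t ^ 4 * e +
        288708 * t ^ 4 * e ^ 2 +
        449984 * t ^ 4 * e ^ 3 +
        417200 * t ^ 4 * e ^ 4 +
        237280 * t ^ 4 * e ^ 5 +
        80736 * t ^ 4 * e ^ 6 +
        14976 * t ^ 4 * e ^ 7 +
        1152 * t ^ 4 * e ^ 8 +
        6644 * t ^ 5 +
        49752 * t ^ 5 * e +
        135508 * t ^ 5 * e ^ 2 +
        188320 * t ^ 5 * e ^ 3 +
        149344 * t ^ 5 * e ^ 4 +
        68592 * t ^ 5 * e ^ 5 +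
        16896 * t ^ 5 * e ^ 6 +
        1728 * t ^ 5 * e ^ 7 +
        2668 * t ^ 6 +
        20264 * t ^ 6 * e +
        51980 * t ^ 6 * e ^ 2 +
        65072 * t ^ 6 * e ^ 3 +
        44608 * t ^ 6 * e ^ 4 +
        16800 * t ^ 6 * e ^ 5 +
        3072 * t ^ 6 * e ^ 6 +
        192 * t ^ 6 * e ^ 7 +
        636 * t ^ 7 +
        5328 * t ^ 7 * e +
        13196 * t ^ 7 * e ^ 2 +
        14984 * t ^ 7 * e ^ 3 +
        8800 * t ^ 7 * e ^ 4 +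
        2608 * t ^ 7 * e ^ 5 +
        288 * t ^ 7 * e ^ 6 +
        60 * t ^ 8 +
        704 * t ^ 8 * e +
        1700 * t ^ 8 * e ^ 2 +
        1672 * t ^ 8 * e ^ 3 +
        760 * t ^ 8 * e ^ 4 +
        144 * t ^ 8 * e ^ 5 +
        32 * t ^ 9 * e +
        72 * t ^ 9 * e ^ 2 +
        48 * t ^ 9 * e ^ 3 +
        8 * t ^ 9 * e ^ 4 := by
    ring
  rw [key]
  positivity

/-- **The third-order rational lower bound**: for `y ≥ 1` and `d ≥ 1`, with `S₃ = y + 2d − 2d/y + 2d(2d+1)/y²`,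
`2dy/S₃ + 2d(2d−1)y/S₃² + 2d(2d−1)²y/S₃³ ≥ 2d − 2d/y + 2d(2d+1)/y² − 24d⁴/y³` (the certificate, denominators cleared).
[cite: JansevanRensburgWhittington2013, §3.2 Theorem 8 (arXiv v4 p. 11)] -/
theorem three_blocks_at_third_order_ge {y D : ℝ} (hy : 1 ≤ y) (hD : 1 ≤ D) :
    2 * D - 2 * D / y + 2 * D * (2 * D + 1) / y ^ 2 - 24 * D ^ 4 / y ^ 3 ≤
      2 * D * y / (y + 2 * D - 2 * D / y + 2 * D * (2 * D + 1) / y ^ 2)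
        + 2 * D * (2 * D - 1) * y / (y + 2 * D - 2 * D / y + 2 * D * (2 * D + 1) / y ^ 2) ^ 2
        + 2 * D * (2 * D - 1) ^ 2 * y / (y + 2 * D - 2 * D / y + 2 * D * (2 * D + 1) / y ^ 2) ^ 3 := by
  have hy0 : 0 < y := by linarith
  have hD0 : 0 < D := by linarith
  set N : ℝ := y ^ 3 + 2 * D * y ^ 2 - 2 * D * y + 2 * D * (2 * D + 1) with hN
  have hN0 : 0 < N := by
    have h' : 2 * D * y ^ 2 - 2 * D * y = 2 * D * y * (y - 1) := by ring
    have : 0 ≤ 2 * D * y ^ 2 - 2 * D * y := by rw [h']; exact mul_nonneg (by positivity) (by linarith)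
    have : 0 < y ^ 3 := by positivity
    have : 0 < 2 * D * (2 * D + 1) := by positivity
    linarith
  have hS : y + 2 * D - 2 * D / y + 2 * D * (2 * D + 1) / y ^ 2 = N / y ^ 2 := by
    rw [hN, eq_div_iff (by positivity)]
    field_simp
  rw [hS]
  have hcert := third_order_poly_certificate hy hD
  rw [← hN] at hcert
  rw [← sub_nonneg]
  have key : 2 * D * y / (N / y ^ 2) + 2 * D * (2 * D - 1) * y / (N / y ^ 2) ^ 2 + 2 * D * (2 * D - 1) ^ 2 * y / (N / y ^ 2) ^ 3
        - (2 * D - 2 * D / y + 2 * D * (2 * D + 1) / y ^ 2 - 24 * D ^ 4 / y ^ 3)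
      = (y ^ 3 * (2 * D * y ^ 3 * N ^ 2 + 2 * D * (2 * D - 1) * y ^ 5 * N + 2 * D * (2 * D - 1) ^ 2 * y ^ 7)
          - (2 * D * y ^ 3 - 2 * D * y ^ 2 + 2 * D * (2 * D + 1) * y - 24 * D ^ 4) * N ^ 3) / (y ^ 3 * N ^ 3) := by
    field_simp
  rw [key]
  positivity

/-- ★★★ **THE THIRD-ORDER LOWER ENVELOPE**: `y + 2d − 2d/y + 2d(2d+1)/y² − 24d⁴/y³ ≤ e^{λ_B(y)}` on `ℤ^{d+1}` for every `y ≥ 1` and every `d`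
(`E − y ≥ Σ_{three blocks}(E) ≥ Σ_{three blocks}(S₃)` as `E ≤ S₃`, then the certificate; `d = 0`: `E = y`).
[cite: JansevanRensburgWhittington2013, §3.2 Theorem 8 (arXiv v4 p. 11)] [cite: Beaton2015, §3, Lemma 2] -/
theorem third_order_sub_le_exp_pulledBridgeFreeEnergy (d : ℕ) {y : ℝ} (hy : 1 ≤ y) :
    y + 2 * d - 2 * d / y + 2 * d * (2 * d + 1) / y ^ 2 - 24 * d ^ 4 / y ^ 3 ≤ Real.exp (pulledBridgeFreeEnergy (d + 1) y) := by
  have hy0 : 0 < y := zero_lt_one.trans_le hy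
  rcases Nat.eq_zero_or_pos d with rfl | hd
  · have h := (exp_pulledBridgeFreeEnergy_mem_Icc 0 hy).1
    simpa using h
  have hD : (1 : ℝ) ≤ d := by exact_mod_cast hd
  set E := Real.exp (pulledBridgeFreeEnergy (d + 1) y) with hE
  have hE0 : 0 < E := Real.exp_pos _
  set S : ℝ := y + 2 * d - 2 * d / y + 2 * d * (2 * d + 1) / y ^ 2 with hSdef
  have hES : E ≤ S := exp_pulledBridgeFreeEnergy_le_third_order d hy
  have hEy : y ≤ E := (exp_pulledBridgeFreeEnergy_mem_Icc d hy).1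
  have hblocks := three_blocks_div_le_exp_pulledBridgeFreeEnergy_sub d hy0
  have hd1 : (0 : ℝ) ≤ 2 * d - 1 := by linarith
  -- each block is decreasing in `E`; replace `E` by `S ≥ E`
  have h1 : 2 * d * y / S ≤ 2 * d * y / E := div_le_div_of_nonneg_left (by positivity) hE0 hES
  have h2 : 2 * d * (2 * d - 1) * y / S ^ 2 ≤ 2 * d * (2 * d - 1) * y / E ^ 2 :=
    div_le_div_of_nonneg_left (by positivity) (by positivity) (pow_le_pow_left₀ hE0.le hES 2)
  have h3 : 2 * d * (2 * d - 1) ^ 2 * y / S ^ 3 ≤ 2 * d * (2 * d - 1) ^ 2 * y / E ^ 3 :=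
    div_le_div_of_nonneg_left (by positivity) (by positivity) (pow_le_pow_left₀ hE0.le hES 3)
  have hcert := three_blocks_at_third_order_ge hy hD
  rw [← hSdef] at hcert
  linarith

/-- ★★★ **THE LARGE-FORCE EXPANSION TO THIRD ORDER WITH AN EXPLICIT, DIMENSION-UNIFORM REMAINDER**:
`|e^{λ_B(y)} − (y + 2d − 2d/y + 2d(2d+1)/y²)| ≤ 24d⁴/y³` on `ℤ^{d+1}` for every `y ≥ 1` and every `d` (upper side: the truncation itself is
an upper bound, previous file). [cite: JansevanRensburgWhittington2013, §3.2 Theorem 8 (arXiv v4 p. 11)] -/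
theorem abs_exp_pulledBridgeFreeEnergy_sub_third_order_le (d : ℕ) {y : ℝ} (hy : 1 ≤ y) :
    |Real.exp (pulledBridgeFreeEnergy (d + 1) y) - (y + 2 * d - 2 * d / y + 2 * d * (2 * d + 1) / y ^ 2)| ≤ 24 * d ^ 4 / y ^ 3 := by
  have hy0 : 0 < y := zero_lt_one.trans_le hy
  have hup := exp_pulledBridgeFreeEnergy_le_third_order d hy
  have hlow := third_order_sub_le_exp_pulledBridgeFreeEnergy d hy
  have hK : (0 : ℝ) ≤ 24 * d ^ 4 / y ^ 3 := by positivity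
  rw [abs_le]
  exact ⟨by linarith, by linarith⟩

/-- The one-sided form: `−24d⁴/y³ ≤ e^{λ_B(y)} − S₃ ≤ 0`, `S₃ = y + 2d − 2d/y + 2d(2d+1)/y²` (`y ≥ 1`, every `d`).
[cite: JansevanRensburgWhittington2013, §3.2 Theorem 8 (arXiv v4 p. 11)] -/
theorem exp_pulledBridgeFreeEnergy_sub_third_order_mem_Icc (d : ℕ) {y : ℝ} (hy : 1 ≤ y) :
    Real.exp (pulledBridgeFreeEnergy (d + 1) y) - (y + 2 * d - 2 * d / y + 2 * d * (2 * d + 1) / y ^ 2) ∈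
      Set.Icc (-(24 * (d : ℝ) ^ 4 / y ^ 3)) 0 := by
  have hup := exp_pulledBridgeFreeEnergy_le_third_order d hy
  have hlow := third_order_sub_le_exp_pulledBridgeFreeEnergy d hy
  exact ⟨by linarith, by linarith⟩

end Literature.Probability.RandomPlanarGeometry.SAW.Zd
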